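import Literature.Analysis.FluidPDE.AxisymSwirlL4
import Literature.Analysis.FluidPDE.TaoClassSwirlSqBalance
import Literature.Analysis.FluidPDE.SerrinEnstrophyGronwall
import HarnessLib

/-!
# Lei–Zhang 2017, §3: `v^θ ∈ L^∞L⁴` and `(v^θ)²/r ∈ L²L²` a priori, in Tao's class

Analysis/FluidPDE proof file (theorems only; no definitions, no named facts) on the discharge path
of the named fact `Literature.Analysis.FluidPDE.LeiZhang2017_logModulus_regularity`
(Lei–Zhang 2017, arXiv:1505.02628, Cor. 1.3). §3, p. 9:

> "`d/dt‖v^θ‖⁴_{L⁴} + ‖∇(v^θ)²‖² + ‖(v^θ)²/r‖² ≤ C|∫(vʳ/r)(v^θ)⁴|`, which gives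
> `v^θ ∈ L^∞L⁴`, `|∇(v^θ)²|, (v^θ)²/r ∈ L²L²`."

Along a Tao-class solution `v` on `[0, T]` (`0 < ν`) with axisymmetric slices, bounded swirl
`|Γ| ≤ M`, and a nonnegative integrable majorant `β` of `‖vʳ/r(t)‖_∞` on `(0, T)`, Grönwall's lemma
(lower-integral form, `lintegral_gronwall_le`) applied to the balance
`‖v^θ(b)‖⁴₄ = ‖v^θ(0)‖⁴₄ + 4∫₀ᵇ∫Γ²ΦΦ'` (`TaoClassSwirlSqBalance`) and the fixed-time estimate
`∫Γ²ΦΦ' + (ν/2)∫Γ²|∇Φ|² + (ν/2)∫ΓΦ³ ≤ β ‖v^θ‖⁴₄` (`AxisymSwirlL4`) gives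

* `IsTaoSolutionOn.swirlL4_apriori` — `‖v^θ(b)‖⁴₄ ≤ ‖v^θ(0)‖⁴₄ exp(4∫₀ᵀβ)` for `b ∈ [0, T]`, and
  `∫⁻₀ᵇ (ν/2)(∫Γ²|∇Φ|² + ∫ΓΦ³) ≤ ¼‖v^θ(0)‖⁴₄ + ‖v^θ(0)‖⁴₄ exp(4∫₀ᵀβ) ∫₀ᵀβ`
  (here `‖v^θ‖⁴₄ = ∫Γ²Φ²`, `∫ΓΦ³ = ‖(v^θ)²/r‖²₂`).

## References

* Z. Lei, Q. S. Zhang, Pacific J. Math. 289 (2017) 169–187, arXiv:1505.02628, §3, p. 9. [`LeiZhang2017`]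
-/

noncomputable section

open MeasureTheory Set Function Filter Topology InnerProductSpace WithLp
open scoped RealInnerProductSpace ContDiff ENNReal NNReal Topology

namespace Literature.Analysis.FluidPDE

section Apriori

variable {T ν : ℝ} {u₀ : EuclideanSpace ℝ (Fin 3) → EuclideanSpace ℝ (Fin 3)}
  {v : ℝ → EuclideanSpace ℝ (Fin 3) → EuclideanSpace ℝ (Fin 3)} {q : ℝ → EuclideanSpace ℝ (Fin 3) → ℝ}


/-- `ENNReal.ofReal (∫ f) ≤ ∫⁻ ENNReal.ofReal f` for every real `f`. [folklore] -/
private theorem ofReal_integral_le_lintegral_ofReal_aux {α : Type*} [MeasurableSpace α] {μ : Measure α}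
    (f : α → ℝ) : ENNReal.ofReal (∫ a, f a ∂μ) ≤ ∫⁻ a, ENNReal.ofReal (f a) ∂μ := by
  by_cases hf : Integrable f μ
  · calc ENNReal.ofReal (∫ a, f a ∂μ) ≤ ENNReal.ofReal (∫ a, max (f a) 0 ∂μ) :=
          ENNReal.ofReal_le_ofReal (integral_mono hf hf.pos_part fun a => le_max_left _ _)
      _ = ∫⁻ a, ENNReal.ofReal (max (f a) 0) ∂μ :=
          ofReal_integral_eq_lintegral_ofReal hf.pos_part (Eventually.of_forall fun a => le_max_right _ _)
      _ = ∫⁻ a, ENNReal.ofReal (f a) ∂μ := lintegral_congr fun a => by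
          rcases le_total (f a) 0 with h | h
          · rw [max_eq_right h, ENNReal.ofReal_zero, ENNReal.ofReal_of_nonpos h]
          · rw [max_eq_left h]
  · rw [integral_undef hf, ENNReal.ofReal_zero]
    exact bot_le

/-- **`v^θ ∈ L^∞L⁴`, `(v^θ)²/r ∈ L²L²` a priori** (Lei–Zhang 2017, §3, p. 9) along a Tao-class
solution with axisymmetric slices, bounded swirl and an integrable majorant `β ≥ 0` of `|vʳ/r|`.
See the module docstring. [cite: LeiZhang2017, §3, p. 9] -/
theorem IsTaoSolutionOn.swirlL4_apriori (h : IsTaoSolutionOn T ν u₀ v q) (hT : 0 < T) (hν : 0 < ν)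
    (hax : ∀ t ∈ Icc 0 T, IsAxisymmetric (v t)) {M : ℝ} (hbd : ∀ t ∈ Icc 0 T, ∀ x, |swirl (v t) x| ≤ M)
    {β : ℝ → ℝ} (hβ0 : ∀ t, 0 ≤ β t) (hβi : IntegrableOn β (Ioo 0 T))
    (hWβ : ∀ t ∈ Ioo 0 T, ∀ x, |radVelQuot (v t) x| ≤ β t) {b : ℝ} (hb : b ∈ Icc 0 T) :
    (∫ x, swirl (v b) x ^ 2 * angVelQuot (v b) x ^ 2) ≤
      (∫ x, swirl (v 0) x ^ 2 * angVelQuot (v 0) x ^ 2) * Real.exp (4 * ∫ t in Ioo 0 T, β t) ∧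
    ∃ ψ : ℝ → ℝ, IntegrableOn ψ (Ioo 0 T) ∧
      (∀ t ∈ Ioo 0 T, ν / 2 * ((∫ x, swirl (v t) x ^ 2 *
        (fderiv ℝ (angVelQuot (v t)) x (EuclideanSpace.single 0 1) ^ 2 +
          fderiv ℝ (angVelQuot (v t)) x (EuclideanSpace.single 1 1) ^ 2 +
          fderiv ℝ (angVelQuot (v t)) x (EuclideanSpace.single 2 1) ^ 2)) +
        ∫ x, swirl (v t) x * angVelQuot (v t) x ^ 3) ≤ ψ t) ∧
      (∀ t ∈ Ioo 0 T, 0 ≤ ψ t) ∧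
      ∀ b' ∈ Ioc 0 T, ∫ t in Ioo 0 b', ψ t ≤
        (∫ x, swirl (v 0) x ^ 2 * angVelQuot (v 0) x ^ 2) / 4 +
          (∫ x, swirl (v 0) x ^ 2 * angVelQuot (v 0) x ^ 2) * Real.exp (4 * ∫ t in Ioo 0 T, β t) *
            ∫ t in Ioo 0 T, β t := by
  -- names
  set Y : ℝ → ℝ := fun t => ∫ x, swirl (v t) x ^ 2 * angVelQuot (v t) x ^ 2 with hY
  set aY : ℝ → ℝ := fun t => ∫ x, swirl (v t) x ^ 2 * angVelQuot (v t) x *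
    angVelQuot (timeDerivWithin (Icc 0 T) v t) x with haY
  set D : ℝ → ℝ := fun t => ∫ x, swirl (v t) x ^ 2 *
    (fderiv ℝ (angVelQuot (v t)) x (EuclideanSpace.single 0 1) ^ 2 +
      fderiv ℝ (angVelQuot (v t)) x (EuclideanSpace.single 1 1) ^ 2 +
      fderiv ℝ (angVelQuot (v t)) x (EuclideanSpace.single 2 1) ^ 2) with hD
  set P : ℝ → ℝ := fun t => ∫ x, swirl (v t) x * angVelQuot (v t) x ^ 3 with hP
  set Iβ : ℝ := ∫ t in Ioo 0 T, β t with hIβ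
  have hU : UniqueDiffOn ℝ (Icc 0 T) := uniqueDiffOn_Icc hT
  have hvs : ∀ t ∈ Icc 0 T, ContDiff ℝ ∞ (v t) := fun t ht => h.classical.contDiff_velocity ht
  have hM0 : 0 ≤ M := (abs_nonneg _).trans (hbd 0 ⟨le_rfl, hT.le⟩ 0)
  have hIβ0 : 0 ≤ Iβ := setIntegral_nonneg measurableSet_Ioo fun t _ => hβ0 t
  -- nonnegativity
  have hY0 : ∀ t, 0 ≤ Y t := fun t => integral_nonneg fun x => by positivity
  have hD0 : ∀ t, 0 ≤ D t := fun t => integral_nonneg fun x => by positivity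
  have hP0 : ∀ t ∈ Icc 0 T, 0 ≤ P t := by
    intro t ht
    refine integral_nonneg fun x => ?_
    have e := (hax t ht).cylRadius_sq_mul_angVelQuot ((hvs t ht).of_le (by norm_cast)) x
    have : swirl (v t) x * angVelQuot (v t) x ^ 3 = cylRadius x ^ 2 * angVelQuot (v t) x ^ 4 := by
      rw [← e]; ring
    rw [this]; positivity
  -- the balance
  obtain ⟨iaY, hbal⟩ := h.integral_swirlSq_angVelQuotSq_eq hT hax hbd
  -- the slice inequality on `(0, T)`
  obtain ⟨B, -, hB⟩ := h.exists_bound_velocity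
  obtain ⟨B', -, hB'⟩ := h.exists_bound_fderiv_velocity
  have hslice : ∀ t ∈ Ioo 0 T, aY t + ν / 2 * D t + ν / 2 * P t ≤ β t * Y t := by
    intro t ht
    have htI : t ∈ Icc 0 T := Ioo_subset_Icc_self ht
    obtain ⟨hΦ0, hΦ1, hΦ2, hq⟩ := h.memLp_angVelQuot_data hax htI
    exact h.classical.swirl_L4_le hU hax hν.le htI (hB t htI) (hB' t htI) (hbd t htI) (hWβ t ht)
      hΦ0 hΦ1 hΦ2 hq
  have haYle : ∀ t ∈ Ioo 0 T, aY t ≤ β t * Y t := fun t ht => by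
    have := hslice t ht
    have := hD0 t
    have := hP0 t (Ioo_subset_Icc_self ht)
    nlinarith
  -- the a-priori bound `Y ≤ M² C₁`
  obtain ⟨C₁, hC₁⟩ := exists_lintegral_sq_iteratedFDeriv_angVelQuot_le hvs hax h.sobolev 0
  have hYbig : ∀ t ∈ Icc 0 T, Y t ≤ M ^ 2 * C₁ := by
    intro t ht
    have hΦc : Continuous (angVelQuot (v t)) :=
      (contDiff_angVelQuot (n := 0) (by exact_mod_cast (hvs t ht).of_le (by norm_cast))).continuous
    have hl : ∫⁻ x, ‖angVelQuot (v t) x‖ₑ ^ 2 ≤ C₁ := by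
      have e0 : ∫⁻ x, ‖angVelQuot (v t) x‖ₑ ^ 2 = ∫⁻ x, ‖iteratedFDeriv ℝ 0 (angVelQuot (v t)) x‖ₑ ^ 2 :=
        lintegral_congr fun x => by rw [← ofReal_norm, ← ofReal_norm, norm_iteratedFDeriv_zero]
      rw [e0]; exact hC₁ t ht
    have hm : MemLp (angVelQuot (v t)) 2 volume := memLp_two_of_lintegral_sq_le_coe hΦc hl
    have hI2 : ∫ x, angVelQuot (v t) x ^ 2 ≤ C₁ := by
      have e1 : ENNReal.ofReal (∫ x, angVelQuot (v t) x ^ 2) = ∫⁻ x, ‖angVelQuot (v t) x‖ₑ ^ 2 := by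
        rw [ofReal_integral_eq_lintegral_ofReal hm.integrable_sq (Eventually.of_forall fun x => by positivity)]
        refine lintegral_congr fun x => ?_
        rw [← ofReal_norm, Real.norm_eq_abs, ← ENNReal.ofReal_pow (abs_nonneg _), sq_abs]
      have := e1 ▸ hl
      exact (ENNReal.ofReal_le_iff_le_toReal ENNReal.coe_ne_top).1 this |>.trans (by simp)
    calc Y t = ∫ x, swirl (v t) x ^ 2 * angVelQuot (v t) x ^ 2 := rfl
      _ ≤ ∫ x, M ^ 2 * angVelQuot (v t) x ^ 2 := by
          refine integral_mono_of_nonneg (Eventually.of_forall fun x => by positivity)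
            (hm.integrable_sq.const_mul _) (Eventually.of_forall fun x => ?_)
          have h1 : swirl (v t) x ^ 2 ≤ M ^ 2 := by
            rw [← sq_abs]; exact pow_le_pow_left₀ (abs_nonneg _) (hbd t ht x) 2
          exact mul_le_mul_of_nonneg_right h1 (sq_nonneg _)
      _ = M ^ 2 * ∫ x, angVelQuot (v t) x ^ 2 := integral_const_mul _ _
      _ ≤ M ^ 2 * C₁ := mul_le_mul_of_nonneg_left hI2 (sq_nonneg M)
  -- Grönwall in lower-integral form
  have hβY : ∀ t ∈ Icc 0 T, ENNReal.ofReal (Y t) ≤ ENNReal.ofReal (Y 0) +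
      ∫⁻ s in Ioo 0 t, ENNReal.ofReal (4 * β s) * ENNReal.ofReal (Y s) := by
    intro t ht
    rcases eq_or_lt_of_le ht.1 with h0 | ht0
    · rw [← h0]; exact le_self_add
    have hsub : Ioo 0 t ⊆ Ioo 0 T := Ioo_subset_Ioo le_rfl ht.2
    have e := hbal t ⟨ht0, ht.2⟩
    calc ENNReal.ofReal (Y t) = ENNReal.ofReal (Y 0 + 4 * ∫ s in Ioo 0 t, aY s) := by rw [hY]; exact congrArg _ e
      _ ≤ ENNReal.ofReal (Y 0) + ENNReal.ofReal (4 * ∫ s in Ioo 0 t, aY s) := ENNReal.ofReal_add_le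
      _ = ENNReal.ofReal (Y 0) + ENNReal.ofReal (∫ s in Ioo 0 t, 4 * aY s) := by rw [integral_const_mul]
      _ ≤ ENNReal.ofReal (Y 0) + ∫⁻ s in Ioo 0 t, ENNReal.ofReal (4 * aY s) :=
          add_le_add le_rfl (ofReal_integral_le_lintegral_ofReal_aux _)
      _ ≤ ENNReal.ofReal (Y 0) + ∫⁻ s in Ioo 0 t, ENNReal.ofReal (4 * β s) * ENNReal.ofReal (Y s) := by
          refine add_le_add le_rfl (setLIntegral_mono' measurableSet_Ioo fun s hs => ?_)
          rw [← ENNReal.ofReal_mul (by linarith [hβ0 s])]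
          refine ENNReal.ofReal_le_ofReal ?_
          have := haYle s (hsub hs)
          nlinarith [hβ0 s]
  have hβfin : ∫⁻ s in Ioo 0 T, ENNReal.ofReal (4 * β s) ≠ ⊤ := by
    rw [← ofReal_integral_eq_lintegral_ofReal (hβi.const_mul 4)
      ((ae_restrict_iff' measurableSet_Ioo).2 (Eventually.of_forall fun s _ => by
        simp only [Pi.zero_apply]; linarith [hβ0 s]))]
    exact ENNReal.ofReal_ne_top
  have hG := lintegral_gronwall_le (S := T) (φ := fun t => ENNReal.ofReal (Y t))
    (a := fun s => ENNReal.ofReal (4 * β s)) (B := ENNReal.ofReal (Y 0)) (M := ENNReal.ofReal (M ^ 2 * C₁))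
    ENNReal.ofReal_ne_top ENNReal.ofReal_ne_top (fun t ht => ENNReal.ofReal_le_ofReal (hYbig t ht))
    hβfin hβY
  -- the exponent is at most `4 Iβ`
  have hexp : ∀ t ∈ Icc 0 T, (∫⁻ s in Ioo 0 t, ENNReal.ofReal (4 * β s)).toReal ≤ 4 * Iβ := by
    intro t ht
    have h1 : ∫⁻ s in Ioo 0 t, ENNReal.ofReal (4 * β s) ≤ ∫⁻ s in Ioo 0 T, ENNReal.ofReal (4 * β s) :=
      lintegral_mono_set (Ioo_subset_Ioo le_rfl ht.2)
    have h2 : ∫⁻ s in Ioo 0 T, ENNReal.ofReal (4 * β s) = ENNReal.ofReal (4 * Iβ) := by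
      rw [← ofReal_integral_eq_lintegral_ofReal (hβi.const_mul 4)
        ((ae_restrict_iff' measurableSet_Ioo).2 (Eventually.of_forall fun s _ => by
          simp only [Pi.zero_apply]; linarith [hβ0 s])),
        integral_const_mul]
    have := ENNReal.toReal_mono ENNReal.ofReal_ne_top (h2 ▸ h1)
    rwa [ENNReal.toReal_ofReal (by positivity)] at this
  have hYmax : ∀ t ∈ Icc 0 T, Y t ≤ Y 0 * Real.exp (4 * Iβ) := by
    intro t ht
    have h1 := hG t ht
    have h2 : ENNReal.ofReal (Y t) ≤ ENNReal.ofReal (Y 0 * Real.exp (4 * Iβ)) := by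
      refine h1.trans ?_
      rw [← ENNReal.ofReal_mul (hY0 0)]
      refine ENNReal.ofReal_le_ofReal (mul_le_mul_of_nonneg_left ?_ (hY0 0))
      exact Real.exp_le_exp.2 (hexp t ht)
    exact (ENNReal.ofReal_le_ofReal_iff (mul_nonneg (hY0 0) (Real.exp_pos _).le)).1 h2
  refine ⟨hYmax b hb, ?_⟩
  -- the majorant `ψ = Ymax β − aY`
  set Ymax : ℝ := Y 0 * Real.exp (4 * Iβ) with hYmax_def
  have hYmax0 : 0 ≤ Ymax := mul_nonneg (hY0 0) (Real.exp_pos _).le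
  set ψ : ℝ → ℝ := fun t => Ymax * β t - aY t with hψ
  have iψ : IntegrableOn ψ (Ioo 0 T) := (hβi.const_mul Ymax).sub iaY
  have hψge : ∀ t ∈ Ioo 0 T, ν / 2 * (D t + P t) ≤ ψ t := by
    intro t ht
    have hs := hslice t ht
    have hYt := hYmax t (Ioo_subset_Icc_self ht)
    have : β t * Y t ≤ Ymax * β t := by nlinarith [hβ0 t]
    simp only [hψ]
    linarith
  have hψ0 : ∀ t ∈ Ioo 0 T, 0 ≤ ψ t := fun t ht => by
    have := hψge t ht
    have := hD0 t
    have := hP0 t (Ioo_subset_Icc_self ht)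
    nlinarith
  refine ⟨ψ, iψ, fun t ht => ?_, hψ0, fun b' hb' => ?_⟩
  · have := hψge t ht
    simp only [hD, hP] at this
    linarith
  · have hsub : Ioo 0 b' ⊆ Ioo 0 T := Ioo_subset_Ioo le_rfl hb'.2
    have iaYb : IntegrableOn aY (Ioo 0 b') := iaY.mono_set hsub
    have iβb : IntegrableOn β (Ioo 0 b') := hβi.mono_set hsub
    have e : ∫ t in Ioo 0 b', ψ t = Ymax * (∫ t in Ioo 0 b', β t) - ∫ t in Ioo 0 b', aY t := by
      simp only [hψ]
      rw [integral_sub (iβb.const_mul Ymax) iaYb, integral_const_mul]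
    rw [e]
    have hβb : ∫ t in Ioo 0 b', β t ≤ Iβ :=
      setIntegral_mono_set hβi (Eventually.of_forall hβ0) (Eventually.of_forall hsub)
    have hbal' : Y b' = Y 0 + 4 * ∫ t in Ioo 0 b', aY t := hbal b' hb'
    have hYb := hY0 b'
    have h1 : -(∫ t in Ioo 0 b', aY t) ≤ Y 0 / 4 := by linarith
    have h2 := mul_le_mul_of_nonneg_left hβb hYmax0
    linarith

end Apriori

end Literature.Analysis.FluidPDE
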